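import Literature.AlgebraicGeometry.Resolution.HasseSchmidtTransverseOrder
import Literature.AlgebraicGeometry.Resolution.SmoothCoordinates
import Mathlib.RingTheory.Smooth.AdicCompletion
import Mathlib.RingTheory.AdicCompletion.Completeness
import Mathlib.RingTheory.Kaehler.JacobiZariski
import Mathlib.RingTheory.Kaehler.Polynomial
import Mathlib.RingTheory.TensorProduct.Free
import HarnessLib

/-!
# Hasse–Schmidt derivations dual to a regular system of parameters EXIST at the points of a scheme
# smooth over a perfect field (EGA IV₄ 16.11.2 along local coordinates; the higher-order form of
# Matsumura Thm. 30.6 (ii))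

Topic: `Literature/AlgebraicGeometry/Resolution`. Companion of `HasseSchmidtTransverseOrder.lean` (the structure
`HasseSchmidtDerivation R A`: components `D_n : A →ₗ[R] A`, `D_0 = id`, higher Leibniz rule; `isDiffOpLE_op`: each
`D_n` is a differential operator of order `≤ n` in Grothendieck's sense; `taylorHom` / `ofRingHom`: Hasse–Schmidt
derivations are the ring maps `A → A⟦T⟧` reducing to the identity), whose design notes say: «Existence of a transverse
Hasse–Schmidt derivation at a point of a variety smooth over a perfect field (EGA IV₄ 16.11.2: the `D_p` along a regular
system of parameters) is NOT constructed here beyond the polynomial ring». This file CONSTRUCTS them, in the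
local-algebra form used by `SmoothCoordinates.lean` (first-order dual derivations `δ_i(u_j) = δ_{ij}`, Matsumura
Thm. 30.6 (ii)):

* `exists_algHom_powerSeries_of_formallySmooth` — **Taylor morphisms**: if `O` is formally smooth over `S` (both
  `K`-algebras), every `K`-algebra map `τ : S → O⟦t⟧` reducing to `S → O` modulo `t` extends to `φ : O → O⟦t⟧` reducing
  to the identity (`O⟦t⟧` is `t`-adically complete: Mathlib `Algebra.FormallySmooth.exists_mkₐ_comp_eq_of_isAdicComplete`);
* `exists_hasseSchmidtDerivation_of_algHom_powerSeries` — its coefficients form a Hasse–Schmidt derivation of `O/K`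
  (`HasseSchmidtDerivation.ofRingHom`);
* `formallySmooth_mvPolynomial_of_span_eq_maximalIdeal` — **a local algebra `A`, essentially of finite type and formally
  smooth over a field `k` with formally smooth residue field (automatic over a PERFECT `k`), is formally smooth over the
  coordinate ring `k[X_i] → A`, `X_i ↦ u_i`, of any minimal system of generators `u` of `𝔪_A`**: the `du_i` are part of a
  basis of `Ω_{A/k}` (`exists_retraction_of_formallySmooth`), so `A ⊗ Ω_{k[X]/k} → Ω_{A/k}` is split injective, whence
  `H₁(L_{A/k[X]}) = 0` by the Jacobi–Zariski sequence (Mathlib `Algebra.H1Cotangent.exact_map_δ`,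
  `exact_δ_mapBaseChange`) and `Ω_{A/k[X]}` is a direct summand of the projective `Ω_{A/k}`;
* `exists_hasseSchmidtDerivation_dual` — **THE EXISTENCE THEOREM**: for such `A`, every minimal generating family
  `u : ι → 𝔪_A` and every index `i` there is a Hasse–Schmidt derivation `D` of `A` over `k` with `D_1 u_i = 1`,
  `D_1 u_l = 0` (`l ≠ i`), `D_b u_l = 0` (`b ≥ 2`) — the coefficients of the Taylor morphism extending
  `X_i ↦ u_i + t`, `X_l ↦ u_l`. Apply it to `A = 𝒪_{X,x}` for `X` smooth over a perfect field and ANY point `x`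
  (`essFiniteType_stalk_overHom`, `formallySmooth_stalk_overHom` of `DerivativeIdealsSupport.lean`,
  `formallySmooth_residueField_of_perfectField` of `SmoothCoordinates.lean`).

All statements are existence THEOREMS (no new definitions): consumers `obtain` the derivations.

## What is NOT here

* Iterativity `D_i ∘ D_j = (i+j choose i) D_{i+j}` and the commutation of the derivations for different `i` (true for
  these Taylor coefficients, not needed downstream); the multi-variable Taylor morphism `A → A⟦t_1, …, t_n⟧`.
* Uniqueness of the extension (it holds — `k[X] → A` is even formally étale at a closed point with separable residue
  field, `KollarEtaleCoordinates.formallyUnramified_mvPolynomial_of_span_eq_maximalIdeal` — but is not used).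
* The basis statement of EGA IV₄ 16.11.2 (`Diff^{≤ m}` free on the `D_ν`, `|ν| ≤ m`) for `A`; the polynomial-ring case is
  `HasseSchmidtDiffBasis.lean` / `HasseSchmidtDiffEqDiffOp.lean`.

## Sources

* [EGAIV4] A. Grothendieck, J. Dieudonné, ÉGA IV₄, Publ. Math. IHÉS 32 (1967), Thm. 16.11.2 (differential operators
  along a system of local coordinates `z_i`: the `D_ν` with `D_ν(z^μ) = (μ choose ν) z^{μ-ν}`), §16.8.
* [Matsumura1987] H. Matsumura, *Commutative Ring Theory* (1986), §27 (higher derivations = ring maps into `A⟦t⟧`),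
  Thm. 28.7 (formal smoothness and differentials), Thm. 30.6 (ii) (dual derivations `D_i a_j = δ_ij`).
* [StacksProject] The Stacks Project, Tag 00S2 (Jacobi–Zariski sequence), Tag 031J (formal smoothness).
-/

noncomputable section

namespace Literature.AlgebraicGeometry.Resolution

open PowerSeries IsLocalRing TensorProduct KaehlerDifferential

universe u v w

/-! ## Taylor morphisms `O → O⟦t⟧` from formal smoothness over a coordinate ring -/

section Taylor

variable {K : Type u} [CommRing K] {S : Type v} [CommRing S] [Algebra K S]
  {O : Type w} [CommRing O] [Algebra K O] [Algebra S O] [IsScalarTower K S O]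

/-- **Taylor morphism.** If `O` is formally smooth over `S` (both `K`-algebras, `S → O`), then every
`K`-algebra map `τ : S → O⟦t⟧` reducing to `S → O` modulo `t` extends to a `K`-algebra map
`φ : O → O⟦t⟧` reducing to the identity modulo `t` (`O⟦t⟧` is `t`-adically complete; Mathlib
`Algebra.FormallySmooth.exists_mkₐ_comp_eq_of_isAdicComplete`). [cite: EGAIV4, Thm. 16.11.2] -/
theorem exists_algHom_powerSeries_of_formallySmooth [Algebra.FormallySmooth S O]
    (τ : S →ₐ[K] PowerSeries O) (hτ : ∀ s, constantCoeff (τ s) = algebraMap S O s) :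
    ∃ φ : O →ₐ[K] PowerSeries O,
      (∀ f, constantCoeff (φ f) = f) ∧ ∀ s, φ (algebraMap S O s) = τ s := by
  letI alg : Algebra S (PowerSeries O) := τ.toRingHom.toAlgebra
  haveI : IsScalarTower K S (PowerSeries O) := IsScalarTower.of_algebraMap_eq fun c => by
    change algebraMap K (PowerSeries O) c = τ (algebraMap K S c)
    rw [τ.commutes]
  let I : Ideal (PowerSeries O) := Ideal.span {X}
  let f₀ : O →ₐ[S] PowerSeries O ⧸ I :=
    { toRingHom := (Ideal.Quotient.mk I).comp (C (R := O))
      commutes' := fun s => by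
        change Ideal.Quotient.mk I (C (algebraMap S O s)) = Ideal.Quotient.mk I (τ s)
        rw [Ideal.Quotient.eq, Ideal.mem_span_singleton, X_dvd_iff, map_sub, constantCoeff_C, hτ,
          sub_self] }
  obtain ⟨φ, hφ⟩ := Algebra.FormallySmooth.exists_mkₐ_comp_eq_of_isAdicComplete (I := I) f₀
  refine ⟨φ.restrictScalars K, fun f => ?_, fun s => φ.commutes s⟩
  have h := AlgHom.congr_fun hφ f
  change Ideal.Quotient.mk I (φ f) = Ideal.Quotient.mk I (C f) at h
  rw [Ideal.Quotient.eq, Ideal.mem_span_singleton, X_dvd_iff, map_sub, constantCoeff_C,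
    sub_eq_zero] at h
  exact h

omit [Algebra S O] [IsScalarTower K S O] in
/-- **The coefficients of a Taylor morphism form a Hasse–Schmidt derivation**: for a `K`-algebra map
`φ : O → O⟦t⟧` with `φ ≡ id (mod t)`, `D_a f :=` the coefficient of `t^a` in `φ f` defines a
Hasse–Schmidt derivation of `O` over `K` (`D_0 = id`; the higher Leibniz rule is the Cauchy product
of power series). [cite: Matsumura1987, §27 (higher derivations ↔ ring maps into `A⟦t⟧`)] -/
theorem exists_hasseSchmidtDerivation_of_algHom_powerSeries (φ : O →ₐ[K] PowerSeries O)
    (hφ : ∀ f, constantCoeff (φ f) = f) :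
    ∃ D : HasseSchmidtDerivation K O, ∀ a f, D.op a f = coeff a (φ f) :=
  ⟨HasseSchmidtDerivation.ofRingHom φ.toRingHom hφ fun r => by
      rw [AlgHom.toRingHom_eq_coe, RingHom.coe_coe, φ.commutes, PowerSeries.algebraMap_apply],
    fun _ _ => rfl⟩

end Taylor

/-! ## Formal smoothness over the coordinate ring `k[X_1, …, X_n] → A`, `X_i ↦ u_i` -/

section Coordinates

variable {k : Type u} {A : Type v} [Field k] [CommRing A] [IsLocalRing A] [Algebra k A]
  [Algebra.EssFiniteType k A] [Algebra.FormallySmooth k A]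
  [Algebra.FormallySmooth k (ResidueField A)]

/-- **A local algebra, essentially of finite type and formally smooth over a field `k` with formally
smooth residue field, is formally smooth over the polynomial ring on a minimal system of generators
of its maximal ideal** (`k[X_i] → A`, `X_i ↦ u_i`): the differentials `du_i` are part of a basis of
`Ω_{A/k}` (`exists_retraction_of_formallySmooth`, Matsumura Thm. 30.6), so
`A ⊗ Ω_{k[X]/k} → Ω_{A/k}` is split injective; by the Jacobi–Zariski sequence
`H₁(L_{A/k}) → H₁(L_{A/k[X]}) → A ⊗ Ω_{k[X]/k} → Ω_{A/k}` the module `H₁(L_{A/k[X]})` vanishes, and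
`Ω_{A/k[X]}`, a direct summand of `Ω_{A/k}`, is projective. [cite: Matsumura1987, Thm. 30.6 (ii); Thm. 28.7]
[cite: StacksProject, Tag 00S2 (Jacobi–Zariski sequence)] -/
theorem formallySmooth_mvPolynomial_of_span_eq_maximalIdeal {ι : Type w} [Fintype ι]
    [DecidableEq ι] (u : ι → A) (hu : Ideal.span (Set.range u) = maximalIdeal A)
    (hcard : Fintype.card ι = (maximalIdeal A).spanFinrank) :
    letI : Algebra (MvPolynomial ι k) A := (MvPolynomial.aeval u).toRingHom.toAlgebra
    Algebra.FormallySmooth (MvPolynomial ι k) A := by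
  letI : Algebra (MvPolynomial ι k) A := (MvPolynomial.aeval u).toRingHom.toAlgebra
  haveI : IsScalarTower k (MvPolynomial ι k) A := IsScalarTower.of_algebraMap_eq fun c => by
    change algebraMap k A c = MvPolynomial.aeval u (algebraMap k (MvPolynomial ι k) c)
    rw [AlgHom.commutes]
  set S := MvPolynomial ι k with hSdef
  have halg : ∀ i, algebraMap S A (MvPolynomial.X i) = u i := fun i => by
    change MvPolynomial.aeval u (MvPolynomial.X i) = u i
    rw [MvPolynomial.aeval_X]
  obtain ⟨ρ, hρ⟩ := exists_retraction_of_formallySmooth (k := k) u hu hcard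
  -- `ψ : A^ι → Ω[A/k]`, `e_i ↦ du_i`; `e : A^ι → A ⊗ Ω[S/k]`, `e_i ↦ 1 ⊗ dX_i`
  set ψ : (ι → A) →ₗ[A] Ω[A⁄k] := Fintype.linearCombination A (fun i => D k A (u i)) with hψdef
  set e : (ι → A) →ₗ[A] A ⊗[S] Ω[S⁄k] :=
    Fintype.linearCombination A (fun i => (1 : A) ⊗ₜ[S] D k S (MvPolynomial.X i)) with hedef
  set mbc := KaehlerDifferential.mapBaseChange k S A with hmbcdef
  have hmbc_e : mbc ∘ₗ e = ψ := by
    refine LinearMap.ext fun f => ?_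
    rw [LinearMap.comp_apply, hedef, Fintype.linearCombination_apply, map_sum, hψdef,
      Fintype.linearCombination_apply]
    refine Finset.sum_congr rfl fun i _ => ?_
    rw [map_smul, hmbcdef, KaehlerDifferential.mapBaseChange_tmul, one_smul,
      KaehlerDifferential.map_D, halg]
  have he_surj : Function.Surjective e := by
    rw [← LinearMap.range_eq_top, hedef, Fintype.range_linearCombination]
    have hb := (Algebra.TensorProduct.basis A (KaehlerDifferential.mvPolynomialBasis k ι)).span_eq
    rw [← hb]
    congr 1
    ext w
    simp only [Set.mem_range, Algebra.TensorProduct.basis_apply,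
      KaehlerDifferential.mvPolynomialBasis_apply]
    exact Iff.rfl
  -- `mbc` is split injective with retraction `e ∘ ρ`
  have hret : (e ∘ₗ ρ) ∘ₗ mbc = LinearMap.id := by
    refine LinearMap.ext fun w => ?_
    obtain ⟨f, rfl⟩ := he_surj w
    rw [LinearMap.comp_apply, LinearMap.comp_apply, LinearMap.id_apply, ← LinearMap.comp_apply mbc e,
      hmbc_e, ← LinearMap.comp_apply ρ ψ, hρ, LinearMap.id_apply]
  have hinj : Function.Injective mbc := by
    intro w₁ w₂ h
    have := congrArg (e ∘ₗ ρ) h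
    rwa [← LinearMap.comp_apply, ← LinearMap.comp_apply (e ∘ₗ ρ), hret, LinearMap.id_apply,
      LinearMap.id_apply] at this
  -- `H₁(L_{A/S}) = 0` by the Jacobi–Zariski sequence
  have hH1 : Subsingleton (Algebra.H1Cotangent S A) := by
    refine ⟨fun a b => ?_⟩
    suffices h : ∀ x : Algebra.H1Cotangent S A, x = 0 by rw [h a, h b]
    intro x
    have h1 : mbc (Algebra.H1Cotangent.δ k S A x) = 0 :=
      (Algebra.H1Cotangent.exact_δ_mapBaseChange k S A).apply_apply_eq_zero x
    have h2 : Algebra.H1Cotangent.δ k S A x = 0 := hinj (by rw [h1, map_zero])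
    obtain ⟨y, hy⟩ := ((Algebra.H1Cotangent.exact_map_δ k S A) x).mp h2
    rw [← hy, Subsingleton.elim y 0, map_zero]
  -- `Ω[A/S]` is a direct summand of the projective module `Ω[A/k]`
  set s := KaehlerDifferential.map k S A A with hsdef
  have hs : Function.Surjective s := KaehlerDifferential.map_surjective k S A
  have hexact : Function.Exact mbc s := KaehlerDifferential.exact_mapBaseChange_map k S A
  set π : Ω[A⁄k] →ₗ[A] Ω[A⁄k] := LinearMap.id - mbc ∘ₗ (e ∘ₗ ρ) with hπdef
  have hπker : LinearMap.ker s ≤ LinearMap.ker π := by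
    intro w hw
    rw [LinearMap.mem_ker] at hw ⊢
    obtain ⟨v, rfl⟩ := (hexact w).mp hw
    have hv : (e ∘ₗ ρ) (mbc v) = v := by
      have := LinearMap.congr_fun hret v
      rwa [LinearMap.comp_apply, LinearMap.id_apply] at this
    rw [hπdef, LinearMap.sub_apply, LinearMap.id_apply, LinearMap.comp_apply, hv, sub_self]
  let i : Ω[A⁄S] →ₗ[A] Ω[A⁄k] :=
    ((LinearMap.ker s).liftQ π hπker) ∘ₗ (s.quotKerEquivOfSurjective hs).symm.toLinearMap
  have hi : ∀ w, i (s w) = π w := fun w => by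
    change ((LinearMap.ker s).liftQ π hπker) ((s.quotKerEquivOfSurjective hs).symm (s w)) = π w
    have : (s.quotKerEquivOfSurjective hs).symm (s w) = Submodule.Quotient.mk w := by
      rw [LinearEquiv.symm_apply_eq, LinearMap.quotKerEquivOfSurjective_apply_mk]
    rw [this, Submodule.liftQ_apply]
  have hsi : s ∘ₗ i = LinearMap.id := by
    refine LinearMap.ext fun z => ?_
    obtain ⟨w, rfl⟩ := hs z
    rw [LinearMap.comp_apply, hi, LinearMap.id_apply, hπdef, LinearMap.sub_apply, map_sub,
      LinearMap.id_apply, LinearMap.comp_apply, hexact.apply_apply_eq_zero, sub_zero]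
  have hproj : Module.Projective A Ω[A⁄S] := Module.Projective.of_split i s hsi
  exact ⟨hproj, hH1⟩


/-- **Hasse–Schmidt derivations dual to a minimal system of generators of `𝔪` exist** (local-algebra
form of EGA IV₄ 16.11.2 «the `D_ν` along a system of local coordinates», in every characteristic): for
`A` local, essentially of finite type and formally smooth over a field `k` with formally smooth residue
field (e.g. `𝒪_{X,x}` for `X` smooth over a PERFECT field `k`, ANY point `x`), every minimal generating
family `u : ι → 𝔪_A` and every `i`, there is a Hasse–Schmidt derivation `D = (D_b)_b` of `A` over `k`
(tree structure `HasseSchmidtDerivation`: `D_0 = id`, higher Leibniz rule; each `D_b` is a differential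
operator of order `≤ b`, `HasseSchmidtDerivation.isDiffOpLE_op`) with `D_1 u_i = 1`, `D_1 u_l = 0`
(`l ≠ i`) and `D_b u_l = 0` for all `b ≥ 2` and all `l` — the coefficients of the Taylor morphism
`A → A⟦t⟧` extending `X_i ↦ u_i + t`, `X_l ↦ u_l`. [cite: EGAIV4, Thm. 16.11.2]
[cite: Matsumura1987, Thm. 30.6 (ii) (first-order case)] -/
theorem exists_hasseSchmidtDerivation_dual {ι : Type w} [Fintype ι] [DecidableEq ι] (u : ι → A)
    (hu : Ideal.span (Set.range u) = maximalIdeal A)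
    (hcard : Fintype.card ι = (maximalIdeal A).spanFinrank) (i : ι) :
    ∃ D : HasseSchmidtDerivation k A,
      ∀ b l, D.op b (u l) = if b = 0 then u l else if b = 1 ∧ l = i then 1 else 0 := by
  letI alg : Algebra (MvPolynomial ι k) A := (MvPolynomial.aeval u).toRingHom.toAlgebra
  haveI : IsScalarTower k (MvPolynomial ι k) A := IsScalarTower.of_algebraMap_eq fun c => by
    change algebraMap k A c = MvPolynomial.aeval u (algebraMap k (MvPolynomial ι k) c)
    rw [AlgHom.commutes]
  haveI : Algebra.FormallySmooth (MvPolynomial ι k) A :=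
    formallySmooth_mvPolynomial_of_span_eq_maximalIdeal (k := k) u hu hcard
  -- the Taylor substitution `X_i ↦ u_i + t`, `X_l ↦ u_l`
  let τ : MvPolynomial ι k →ₐ[k] PowerSeries A :=
    MvPolynomial.aeval fun l => C (u l) + if l = i then X else 0
  have hτX : ∀ l, τ (MvPolynomial.X l) = C (u l) + if l = i then X else 0 := fun l =>
    MvPolynomial.aeval_X _ l
  have hτ : ∀ s, constantCoeff (τ s) = algebraMap (MvPolynomial ι k) A s := by
    intro s
    change ((constantCoeff (R := A)).comp τ.toRingHom) s = (MvPolynomial.aeval u).toRingHom s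
    congr 1
    refine MvPolynomial.ringHom_ext (fun r => ?_) (fun l => ?_)
    · change constantCoeff (τ (algebraMap k (MvPolynomial ι k) r)) =
        MvPolynomial.aeval u (algebraMap k (MvPolynomial ι k) r)
      rw [τ.commutes, AlgHom.commutes, PowerSeries.algebraMap_apply, constantCoeff_C]
    · change constantCoeff (τ (MvPolynomial.X l)) = MvPolynomial.aeval u (MvPolynomial.X l)
      rw [hτX, MvPolynomial.aeval_X, map_add, constantCoeff_C]
      split_ifs
      · rw [constantCoeff_X, add_zero]
      · rw [map_zero, add_zero]
  obtain ⟨φ, hφ0, hφτ⟩ := exists_algHom_powerSeries_of_formallySmooth (K := k) τ hτ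
  obtain ⟨D, hD⟩ := exists_hasseSchmidtDerivation_of_algHom_powerSeries (K := k) φ hφ0
  refine ⟨D, fun b l => ?_⟩
  have hul : u l = algebraMap (MvPolynomial ι k) A (MvPolynomial.X l) := by
    change u l = MvPolynomial.aeval u (MvPolynomial.X l)
    rw [MvPolynomial.aeval_X]
  rw [hD, hul, hφτ, hτX, ← hul, map_add, coeff_C]
  rcases Nat.eq_zero_or_pos b with rfl | hb
  · simp only [if_true, add_eq_left]
    split_ifs
    · rw [coeff_X, if_neg (by decide)]
    · rw [map_zero]
  · rw [if_neg hb.ne', if_neg hb.ne', zero_add]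
    split_ifs with hl hbl hbl
    · rw [coeff_X, if_pos hbl.1]
    · rw [coeff_X, if_neg (fun h => hbl ⟨h, hl⟩)]
    · exact absurd hbl.2 hl
    · rw [map_zero]

end Coordinates

end Literature.AlgebraicGeometry.Resolution

end
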